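import Literature.Analysis.FluidPDE.GalerkinEnergyBalanceLongTime
import Summits.AnomalousDissipation.AnomalousDissipation.Theses.DecimationAxis
import HarnessLib

/-!
# Currency changes for the crux `DecimationAxis.GalerkinFloor` (stmt-AnomalousDissipation-1582):
# the registered Tools stub `stub_heartCurrencyTools` of the line `birth` (STUB-PLAN Steps 1 / U6)

Route `AnomalousDissipation/DecimationAxis`, crux `GalerkinFloor`, skeleton `Cruxes/GalerkinFloor/Lines/birth.lean`
(sha b3793ea2…), heart stub `stub_uniformGalerkinAnomaly` ("Heart"); STUB-PLAN
`Cruxes/GalerkinFloor/STUB-PLAN-stub_uniformGalerkinAnomaly.md`, §2 W1 and U6.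

Two certified rewritings of the heart stub, in the skeleton's vocabulary (local notations expanding to
the skeleton's §0 bodies verbatim; the Heart is written out verbatim, it is the registered signature of
`stub_uniformGalerkinAnomaly`):

* `heart_of_galerkinFloor` (U6) — **the crux needs the Heart**: `GalerkinFloor → Heart` (resolved
  dissipation `≤` total dissipation termwise, `liminf` of bounded running means is monotone).  Hence any
  refutation of the Heart refutes the crux by name.
* `heart_iff_injectionPersistence` (W1) — **work currency**: the Heart is equivalent to the same
  statement with the floor on the `liminf`-mean INJECTED POWER `Σ_{k∈S} Re⟪g_k, c_k⟫` instead of the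
  total dissipation (long-time balance `⟨D⟩⁻ = ⟨W⟩⁻` on the punctured ball,
  `IsGalerkinODESolution.longTimeAvgInf_dissipation_eq`).
* the registered conjunction `stub_heartCurrencyTools`.

Sources: folklore (DoeringFoias2002 §2; FoiasManleyRosaTemam2001 Ch. IV App. B).
-/

noncomputable section

-- D-0017: single-problem summit ⇒ the duplicated namespace segment is by design.
set_option linter.dupNamespace false

open Filter Set MeasureTheory
open scoped Topology
open Literature.Analysis.FunctionSpaces Literature.Analysis.FunctionSpaces.Torus
open Literature.Analysis.FluidPDE
open Summit.AnomalousDissipation.AnomalousDissipation.Theses.DecimationAxis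

namespace Summit.AnomalousDissipation.AnomalousDissipation.Theorems.DecimationAxisGalerkinFloor

/-- Lattice frequencies `ℤ³` (local notation, as in the skeleton). -/
local notation "ℤ³" => Fin 3 → ℤ
/-- Fourier coefficient values `ℂ³` (local notation, as in the skeleton). -/
local notation "ℂ³" => EuclideanSpace ℂ (Fin 3)

set_option quotPrecheck false in
/-- The skeleton's `Birth.IsDesignerForce`, body verbatim (local notation). -/
local notation "IsDesignerForce" =>
  fun (N : ℕ) (g : ℤ³ → ℂ³) =>
    IsConjSymm g ∧ (∀ k, k ∉ freqBall N → g k = 0) ∧ g 0 = 0 ∧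
      (∀ k : ℤ³, ∑ i, ((k i : ℤ) : ℂ) * g k i = 0)

set_option quotPrecheck false in
/-- The skeleton's `Birth.IsCoeffTrajectory`, body verbatim (local notation). -/
local notation "IsCoeffTrajectory" =>
  fun (S : Finset ℤ³) (ν : ℝ) (g : ℤ³ → ℂ³) (c : ℝ → ↥S → ℂ³) =>
    (∀ t, c t ∈ galerkinSubspace S) ∧ ContinuousOn c (Set.Ici 0) ∧
      (∀ T : ℝ, ∀ t ∈ Set.Icc (0 : ℝ) T,
        HasDerivWithinAt c (galerkinRHS S ν (fun k => g k) (c t)) (Set.Icc 0 T) t)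

set_option quotPrecheck false in
/-- The skeleton's `Birth.coeffEnergy`, body verbatim (local notation). -/
local notation "coeffEnergy" =>
  fun (c : ℝ → ↥(_ : Finset ℤ³) → ℂ³) (t : ℝ) => ∑ k, ‖c t k‖ ^ 2

set_option quotPrecheck false in
/-- The skeleton's `Birth.coeffDissipation`, body verbatim (local notation). -/
local notation "coeffDissipation" =>
  fun (ν : ℝ) (c : ℝ → ↥(_ : Finset ℤ³) → ℂ³) (t : ℝ) =>
    ν * (4 * Real.pi ^ 2 * ∑ k : ↥(_ : Finset ℤ³), freqNormSq (k : ℤ³) * ‖c t k‖ ^ 2)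

set_option quotPrecheck false in
/-- The skeleton's `Birth.coeffResolvedDissipation`, body verbatim (local notation). -/
local notation "coeffResolvedDissipation" =>
  fun (ν : ℝ) (M : ℕ) (c : ℝ → ↥(_ : Finset ℤ³) → ℂ³) (t : ℝ) =>
    ν * (4 * Real.pi ^ 2 * ∑ k : ↥(_ : Finset ℤ³),
      if freqNormSq (k : ℤ³) ≤ (M : ℝ) ^ 2 then freqNormSq (k : ℤ³) * ‖c t k‖ ^ 2 else 0)

variable {S : Finset ℤ³} {ν : ℝ} {g : ℤ³ → ℂ³} {c : ℝ → ↥S → ℂ³}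

/-! ## Resolved ≤ total -/

/-- Resolved dissipation is at most total dissipation, pointwise (`ν ≥ 0`). -/
theorem coeffResolvedDissipation_le (hν : 0 ≤ ν) (M : ℕ) (c : ℝ → ↥S → ℂ³) (t : ℝ) :
    coeffResolvedDissipation ν M c t ≤ coeffDissipation ν c t := by
  refine mul_le_mul_of_nonneg_left (mul_le_mul_of_nonneg_left (Finset.sum_le_sum fun k _ => ?_)
    (by positivity)) hν
  split_ifs
  · exact le_rfl
  · exact mul_nonneg (freqNormSq_nonneg _) (sq_nonneg _)

/-- Resolved dissipation is nonnegative (`ν ≥ 0`). -/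
theorem coeffResolvedDissipation_nonneg (hν : 0 ≤ ν) (M : ℕ) (c : ℝ → ↥S → ℂ³) (t : ℝ) :
    0 ≤ coeffResolvedDissipation ν M c t := by
  refine mul_nonneg hν (mul_nonneg (by positivity) (Finset.sum_nonneg fun k _ => ?_))
  split_ifs
  · exact mul_nonneg (freqNormSq_nonneg _) (sq_nonneg _)
  · exact le_rfl

/-- `⟨resolved dissipation⟩⁻ ≤ ⟨total dissipation⟩⁻` along a trajectory on a punctured symmetric `S`
(`ν > 0`, real force; the total-dissipation means are bounded by the absorbing ball). -/
theorem longTimeAvgInf_coeffResolvedDissipation_le (hS : ∀ k ∈ S, -k ∈ S) (h0 : (0 : ℤ³) ∉ S)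
    (hν : 0 < ν) (hg : IsConjSymm g) (hc : IsCoeffTrajectory S ν g c) (M : ℕ) :
    longTimeAvgInf (coeffResolvedDissipation ν M c) ≤ longTimeAvgInf (coeffDissipation ν c) := by
  have hα : IsGalerkinODESolution ν (fun k : ↥S => g k) (c 0) c := ⟨rfl, hc.1, hc.2.1, hc.2.2⟩
  unfold longTimeAvgInf
  refine liminf_le_liminf ?_ (isBoundedUnder_ge_timeMean_of_nonneg
    (coeffResolvedDissipation_nonneg hν.le M c))
    (hα.isBoundedUnder_le_timeMean_dissipation hν hS h0 (isRealCoeff_restrict hg)).isCoboundedUnder_ge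
  filter_upwards [eventually_ge_atTop (0 : ℝ)] with T hT
  exact timeMean_mono_of_nonneg hT (IsGalerkinODESolution.dissipation_nonneg hν.le c)
    (integrableOn_Ioc_of_continuousOn_Ici hα.continuousOn_dissipation T)
    fun t _ _ => coeffResolvedDissipation_le hν.le M c t

/-! ## U6 — the crux needs the Heart -/

/-- **U6.** `GalerkinFloor → Heart`: the crux implies the heart stub `stub_uniformGalerkinAnomaly` (same
force, budgets `E`, `2ε`, viscosities, thresholds; resolved `≤` total under the `liminf`-mean).  So a
refutation of the Heart refutes the crux. -/
theorem heart_of_galerkinFloor (h : GalerkinFloor) :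
    ∃ (N : ℕ) (g : ℤ³ → ℂ³), IsDesignerForce N g ∧ ∃ (E ε : ℝ), 0 < ε ∧ ∃ ν : ℕ → ℝ,
      (∀ j, 0 < ν j) ∧ Tendsto ν atTop (nhds 0) ∧
      ∀ j, ∃ K₀ : ℕ, ∀ K, K₀ ≤ K → ∀ S : Finset ℤ³, S = (freqBall K).erase 0 →
        ∃ c : ℝ → ↥S → ℂ³, IsCoeffTrajectory S (ν j) g c ∧
          longTimeAvgSup (coeffEnergy c) ≤ E ∧ ε ≤ longTimeAvgInf (coeffDissipation (ν j) c) := by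
  obtain ⟨N, g, hs, hsupp, hg0, htr, E, ε, hε, ν, hν, hlim, hj⟩ := h
  refine ⟨N, g, ⟨hs, hsupp, hg0, htr⟩, E, 2 * ε, by positivity, ν, hν, hlim, fun j => ?_⟩
  obtain ⟨M, K₀, hK⟩ := hj j
  refine ⟨K₀, fun K hKK S hS => ?_⟩
  obtain ⟨c, h1, h2, h3, hE, hD⟩ := hK K hKK S hS
  refine ⟨c, ⟨h1, h2, h3⟩, hE, hD.trans ?_⟩
  subst hS
  have hsym : ∀ k ∈ (freqBall K).erase (0 : ℤ³), -k ∈ (freqBall K).erase (0 : ℤ³) := fun k hk => by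
    rw [Finset.mem_erase] at hk ⊢
    exact ⟨neg_ne_zero.2 hk.1, neg_mem_freqBall_of_mem k hk.2⟩
  exact longTimeAvgInf_coeffResolvedDissipation_le hsym (Finset.notMem_erase 0 _)
    (hν j) hs ⟨h1, h2, h3⟩ M

/-! ## W1 — work currency -/

/-- **W1.** Heart ⟺ injection persistence: the heart stub is equivalent to the same statement with the
floor on the `liminf`-mean injected power `W(t) = Σ_{k∈S} Re⟪g_k, c_k(t)⟫` (`⟨D⟩⁻ = ⟨W⟩⁻` on the
punctured ball for a real force and `ν > 0`). -/
theorem heart_iff_injectionPersistence :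
    (∃ (N : ℕ) (g : ℤ³ → ℂ³), IsDesignerForce N g ∧ ∃ (E ε : ℝ), 0 < ε ∧ ∃ ν : ℕ → ℝ,
      (∀ j, 0 < ν j) ∧ Tendsto ν atTop (nhds 0) ∧
      ∀ j, ∃ K₀ : ℕ, ∀ K, K₀ ≤ K → ∀ S : Finset ℤ³, S = (freqBall K).erase 0 →
        ∃ c : ℝ → ↥S → ℂ³, IsCoeffTrajectory S (ν j) g c ∧
          longTimeAvgSup (coeffEnergy c) ≤ E ∧ ε ≤ longTimeAvgInf (coeffDissipation (ν j) c)) ↔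
    (∃ (N : ℕ) (g : ℤ³ → ℂ³), IsDesignerForce N g ∧ ∃ (E ε : ℝ), 0 < ε ∧ ∃ ν : ℕ → ℝ,
      (∀ j, 0 < ν j) ∧ Tendsto ν atTop (nhds 0) ∧
      ∀ j, ∃ K₀ : ℕ, ∀ K, K₀ ≤ K → ∀ S : Finset ℤ³, S = (freqBall K).erase 0 →
        ∃ c : ℝ → ↥S → ℂ³, IsCoeffTrajectory S (ν j) g c ∧
          longTimeAvgSup (coeffEnergy c) ≤ E ∧
            ε ≤ longTimeAvgInf (fun t => ∑ k : ↥S, (inner ℂ (g k) (c t k)).re)) := by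
  -- the two floors coincide on every instance
  have key : ∀ (g : ℤ³ → ℂ³), IsConjSymm g → ∀ (ν : ℝ), 0 < ν → ∀ (K : ℕ) (S : Finset ℤ³),
      S = (freqBall K).erase 0 → ∀ c : ℝ → ↥S → ℂ³, IsCoeffTrajectory S ν g c →
        longTimeAvgInf (coeffDissipation ν c) =
          longTimeAvgInf (fun t => ∑ k : ↥S, (inner ℂ (g k) (c t k)).re) := by
    intro g hg ν hν K S hS c hc
    subst hS
    have hα : IsGalerkinODESolution ν (fun k : ↥((freqBall K).erase 0) => g k) (c 0) c :=
      ⟨rfl, hc.1, hc.2.1, hc.2.2⟩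
    have hsym : ∀ k ∈ (freqBall K).erase (0 : ℤ³), -k ∈ (freqBall K).erase (0 : ℤ³) := fun k hk => by
      rw [Finset.mem_erase] at hk ⊢
      exact ⟨neg_ne_zero.2 hk.1, neg_mem_freqBall_of_mem k hk.2⟩
    exact hα.longTimeAvgInf_dissipation_eq hν hsym (Finset.notMem_erase 0 _) (isRealCoeff_restrict hg)
  constructor
  · rintro ⟨N, g, hg, E, ε, hε, ν, hν, hlim, hj⟩
    refine ⟨N, g, hg, E, ε, hε, ν, hν, hlim, fun j => ?_⟩
    obtain ⟨K₀, hK⟩ := hj j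
    refine ⟨K₀, fun K hKK S hS => ?_⟩
    obtain ⟨c, hc, hE, hD⟩ := hK K hKK S hS
    exact ⟨c, hc, hE, (key g hg.1 (ν j) (hν j) K S hS c hc) ▸ hD⟩
  · rintro ⟨N, g, hg, E, ε, hε, ν, hν, hlim, hj⟩
    refine ⟨N, g, hg, E, ε, hε, ν, hν, hlim, fun j => ?_⟩
    obtain ⟨K₀, hK⟩ := hj j
    refine ⟨K₀, fun K hKK S hS => ?_⟩
    obtain ⟨c, hc, hE, hW⟩ := hK K hKK S hS
    exact ⟨c, hc, hE, (key g hg.1 (ν j) (hν j) K S hS c hc).symm ▸ hW⟩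

/-! ## The registered Tools stub -/

/-- **Registered Tools stub `stub_heartCurrencyTools`** (crux stmt-AnomalousDissipation-1582, line
`birth`; STUB-PLAN Steps U6 / W1): `(GalerkinFloor → Heart) ∧ (Heart ↔ InjectionPersistence)` in the
skeleton's vocabulary, signature registered verbatim. -/
theorem stub_heartCurrencyTools :
    (GalerkinFloor → ∃ (N : ℕ) (g : ℤ³ → ℂ³), IsDesignerForce N g ∧ ∃ (E ε : ℝ), 0 < ε ∧ ∃ ν : ℕ → ℝ, (∀ j, 0 < ν j) ∧ Tendsto ν atTop (nhds 0) ∧ ∀ j, ∃ K₀ : ℕ, ∀ K, K₀ ≤ K → ∀ S : Finset ℤ³, S = (freqBall K).erase 0 → ∃ c : ℝ → ↥S → ℂ³, IsCoeffTrajectory S (ν j) g c ∧ longTimeAvgSup (coeffEnergy c) ≤ E ∧ ε ≤ longTimeAvgInf (coeffDissipation (ν j) c)) ∧ ((∃ (N : ℕ) (g : ℤ³ → ℂ³), IsDesignerForce N g ∧ ∃ (E ε : ℝ), 0 < ε ∧ ∃ ν : ℕ → ℝ, (∀ j, 0 < ν j) ∧ Tendsto ν atTop (nhds 0) ∧ ∀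 j, ∃ K₀ : ℕ, ∀ K, K₀ ≤ K → ∀ S : Finset ℤ³, S = (freqBall K).erase 0 → ∃ c : ℝ → ↥S → ℂ³, IsCoeffTrajectory S (ν j) g c ∧ longTimeAvgSup (coeffEnergy c) ≤ E ∧ ε ≤ longTimeAvgInf (coeffDissipation (ν j) c)) ↔ (∃ (N : ℕ) (g : ℤ³ → ℂ³), IsDesignerForce N g ∧ ∃ (E ε : ℝ), 0 < ε ∧ ∃ ν : ℕ → ℝ, (∀ j, 0 < ν j) ∧ Tendsto ν atTop (nhds 0) ∧ ∀ j, ∃ K₀ : ℕ, ∀ K, K₀ ≤ K → ∀ S : Finset ℤ³, S = (freqBall K).erase 0 → ∃ c : ℝ → ↥S → ℂ³, IsCoeffTrajectory S (ν j) g c ∧ longTimeAvgSup (coeffEnergy c) ≤ E ∧ ε ≤ longTimeAvgInf (fun t => ∑ k : ↥S, (inner ℂ (g k) (c t k)).re))) :=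
  ⟨heart_of_galerkinFloor, heart_iff_injectionPersistence⟩

end Summit.AnomalousDissipation.AnomalousDissipation.Theorems.DecimationAxisGalerkinFloor

end
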